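import Literature.Barriers.CriticalPhenomena.LaceExpansionXSpaceMarkedChains
import HarnessLib

/-!
# Marking the diagram of `Π^{(N+1)}` at `p_c`: the marked kernels are the weighted kernels, and a doubly
# marked chain is the chain over the master kernels with two exponents set — PROVED

Barrier catalogue `Literature/Barriers/CriticalPhenomena/` (D-0021). Eighth layer under
`Hara2008_weightedNLoopBoundPc` (`LaceExpansionXSpaceLemma16.lean`). The double weight insertion of
`LaceExpansionXSpaceMarkedChains.lean` produces chains over the master list `masterT d n` with the kernel at
position `j` multiplied by `|φ_j(q) - φ_{j-1}(p)|^b` (path `P₁`) and the kernel at position `l` by the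
`P₂`-analogue. This file identifies those chains with chains over the WEIGHTED kernels of
`LaceExpansionXSpaceWeightedPieces.lean` (`B̃₁^{(b,c)} = kB1w`, `B̃₂^{(b,c)} = kB2W`, the start/end propagators
`kStartW`, `kEndW`), by an explicit list surgery. PROVED:

* identification (`markK_rd1_rd1_kB1w`, `markK_rd2_rd2_kB1w`, `markK_rd1_rd2_kB2W`, `markK_rd2_rd1_kB2W`,
  `markK_…_kStartW`, `markK_…_kEndW`): a mark along the first (second) coordinates sets the first (second)
  exponent slot; for `B₂⁽²⁾` the displacement `t → w'` vanishes (weight `|0|^c`);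
* the master list with exponents `masterTE d n ex` (`ex : ℕ → ℝ × ℝ`, fine index ↦ the two slots), `mKsE` (its
  kernels), `masterT_eq_masterTE` (zero exponents), `pol k` (which slot path `P₁` uses at fine index `k`: the start,
  the odd units, and unit `N` for the last `B₁` and the end), `setB`/`setC` (set the `P₁`- or the `P₂`-slot);
* SURGERY: `markAt₁_blocksTE`, `markAt₁_masterTE` (marking along `P₁` at `j < 2n+3` is `setB`), `markAt_blocksTE_toΨ`,
  `markAt_masterTE_toΨ` (along `P₂`: `setC`), and `dmChain_masterT_eq`: the doubly marked chain is
  `Σ_p (δ₀ · mKsE n (setC (setB 0 j b) l c))(p) δ_diag(p)`.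

## References

* T. Hara, Ann. Probab. 36 (2008) 530–593 (arXiv:math-ph/0504021): §3.4 (Step 1).
* M. Heydenreich, R. van der Hofstad, *Progress in High-Dimensional Percolation and Random Graphs*,
  Springer 2017: (7.4.4), (7.4.10), (7.5.5), §7.5.2 (interchange of top and bottom; the vanishing displacement).
-/

noncomputable section

namespace Literature.Barriers.CriticalPhenomena

open _root_.MeasureTheory _root_.Filter Literature.Probability.LatticeModels
  Literature.Probability.Percolation

open scoped ENNReal

/-! ### Identification of the marked kernels with the weighted kernels -/

section Identify

variable {d : ℕ}

/-- `G^{(0)}(v) |v|^b = G^{(b)}(v)`. [folklore] -/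
theorem gE_zero_mul_wE (b : ℝ) (v : Site d) : gE d 0 v * wE b v = gE d b v := by
  rw [gE_zero_exp, gE_eq, mul_comm]

/-- `G̃^{(0)}(v) |v|^c = G̃^{(c)}(v)`. [folklore] -/
theorem gTildeE_zero_mul_wE (c : ℝ) (v : Site d) : gTildeE d 0 v * wE c v = gTildeE d c v := by
  rw [gTildeE, gTildeE, wE_zero_exp, one_mul, mul_comm]

/-- Marking the first line of a propagator. [folklore] -/
theorem kProp_gE_zero_mul_wE_fst (b : ℝ) (g : Site d → ℝ≥0∞) (p q : Site d × Site d) :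
    kProp (gE d 0) g p q * wE b (q.1 - p.1) = kProp (gE d b) g p q := by
  simp only [kProp]
  rw [mul_right_comm, gE_zero_mul_wE]

/-- Marking the second line of a propagator. [folklore] -/
theorem kProp_gE_zero_mul_wE_snd (c : ℝ) (f : Site d → ℝ≥0∞) (p q : Site d × Site d) :
    kProp f (gE d 0) p q * wE c (q.2 - p.2) = kProp f (gE d c) p q := by
  simp only [kProp]
  rw [mul_assoc, gE_zero_mul_wE]

/-- Marking the pivotal line of a propagator. [folklore] -/
theorem kProp_gTildeE_zero_mul_wE_snd (c : ℝ) (f : Site d → ℝ≥0∞) (p q : Site d × Site d) :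
    kProp f (gTildeE d 0) p q * wE c (q.2 - p.2) = kProp f (gTildeE d c) p q := by
  simp only [kProp]
  rw [mul_assoc, gTildeE_zero_mul_wE]

/-- **`B₁` marked along its `τ`-line**: `B₁ · |z - w|^b = B̃₁^{(b,0)}` (path along the first coordinates).
[cite: Hara2008, §3.4 (Step 1)] -/
theorem markK_rd1_rd1_kB1w (b c₀ : ℝ) : markK b rd1 rd1 (kB1w d 0 c₀) = kB1w d b c₀ := by
  funext p q
  exact kProp_gE_zero_mul_wE_fst b _ p q

/-- **`B₁` marked along its pivotal line**: `B₁ · |t - u|^c = B̃₁^{(b₀,c)}`. [cite: Hara2008, §3.4 (Step 1)] -/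
theorem markK_rd2_rd2_kB1w (c b₀ : ℝ) : markK c rd2 rd2 (kB1w d b₀ 0) = kB1w d b₀ c := by
  funext p q
  exact kProp_gTildeE_zero_mul_wE_snd c _ p q

/-- `B₁` marked along its `τ`-line. [cite: Hara2008, §3.4 (Step 1)] -/
theorem markK_rd1_rd1_kB1 (b : ℝ) : markK b rd1 rd1 (kB1 d) = kB1w d b 0 := by
  rw [← kB1w_zero_zero]; exact markK_rd1_rd1_kB1w b 0

/-- `B₁` marked along its pivotal line. [cite: Hara2008, §3.4 (Step 1)] -/
theorem markK_rd2_rd2_kB1 (c : ℝ) : markK c rd2 rd2 (kB1 d) = kB1w d 0 c := by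
  rw [← kB1w_zero_zero]; exact markK_rd2_rd2_kB1w c 0

/-- `B̃₂⁽¹⁾` marked along its path line `z → u'`. [cite: Hara2008, §3.4 (Step 1)] -/
theorem kB2oneW_mul_wE_path (b c₀ : ℝ) (p q : Site d × Site d) :
    kB2oneW d 0 c₀ p q * wE b (q.2 - p.1) = kB2oneW d b c₀ p q := by
  simp only [kB2oneW, kRungL, kRungR, kPropX]
  rw [show ∀ A B C D E : ℝ≥0∞, A * (B * C * D) * E = A * ((B * E) * C * D) from fun _ _ _ _ _ => by ring,
    gE_zero_mul_wE]

/-- `B̃₂⁽¹⁾` marked along its path line `t → w'`. [cite: Hara2008, §3.4 (Step 1)] -/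
theorem kB2oneW_mul_wE_other (c b₀ : ℝ) (p q : Site d × Site d) :
    kB2oneW d b₀ 0 p q * wE c (q.1 - p.2) = kB2oneW d b₀ c p q := by
  simp only [kB2oneW, kRungL, kRungR, kPropX]
  rw [show ∀ A B C D E : ℝ≥0∞, A * (B * C * D) * E = A * (B * (C * E) * D) from fun _ _ _ _ _ => by ring,
    gE_zero_mul_wE]

/-- `B̃₂⁽²⁾` marked along its path line `z → u'`. [cite: Hara2008, §3.4 (Step 1)] -/
theorem kB2twoW_mul_wE_path (b c₀ : ℝ) (p q : Site d × Site d) :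
    kB2twoW d 0 c₀ p q * wE b (q.2 - p.1) = kB2twoW d b c₀ p q := by
  simp only [kB2twoW]
  split_ifs with h
  · rw [mul_assoc, ← ENNReal.tsum_mul_right]
    congr 1
    refine tsum_congr fun a => ?_
    rw [mul_assoc, gE_zero_mul_wE]
  · simp

/-- `B̃₂⁽²⁾` marked along its vanishing displacement `t → w'` (weight `|0|^c`).
[cite: HeydenreichVanDerHofstad2017, §7.5.2 (the vanishing displacement)] -/
theorem kB2twoW_mul_wE_other (c b₀ : ℝ) (p q : Site d × Site d) :
    kB2twoW d b₀ 0 p q * wE c (q.1 - p.2) = kB2twoW d b₀ c p q := by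
  simp only [kB2twoW]
  split_ifs with h
  · rw [show q.1 - p.2 = 0 from sub_eq_zero.2 h.symm, wE_zero_exp, one_mul, mul_comm]
  · simp

/-- **`B₂` marked along `z → u'`**: `B̃₂^{(0,c₀)} · |u' - z|^b = B̃₂^{(b,c₀)}`. [cite: Hara2008, §3.4 (Step 1)] -/
theorem markK_rd1_rd2_kB2W (b c₀ : ℝ) : markK b rd1 rd2 (kB2W d 0 c₀) = kB2W d b c₀ := by
  funext p q
  simp only [markK, kB2W, rd1, rd2, add_mul, kB2oneW_mul_wE_path, kB2twoW_mul_wE_path]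

/-- **`B₂` marked along `t → w'`**: `B̃₂^{(b₀,0)} · |w' - t|^c = B̃₂^{(b₀,c)}`. [cite: Hara2008, §3.4 (Step 1)] -/
theorem markK_rd2_rd1_kB2W (c b₀ : ℝ) : markK c rd2 rd1 (kB2W d b₀ 0) = kB2W d b₀ c := by
  funext p q
  simp only [markK, kB2W, rd1, rd2, add_mul, kB2oneW_mul_wE_other, kB2twoW_mul_wE_other]

/-- `B₂` marked along `z → u'`. [cite: Hara2008, §3.4 (Step 1)] -/
theorem markK_rd1_rd2_kB2 (b : ℝ) : markK b rd1 rd2 (kB2 d) = kB2W d b 0 := by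
  rw [← kB2W_zero_zero]; exact markK_rd1_rd2_kB2W b 0

/-- `B₂` marked along `t → w'`. [cite: Hara2008, §3.4 (Step 1)] -/
theorem markK_rd2_rd1_kB2 (c : ℝ) : markK c rd2 rd1 (kB2 d) = kB2W d 0 c := by
  rw [← kB2W_zero_zero]; exact markK_rd2_rd1_kB2W c 0

/-- **The start propagator marked** along `0 → w₀` / `0 → u₀`. [cite: Hara2008, §3.4 (Step 1)] -/
theorem markK_rd1_rd1_kStartW (b c₀ : ℝ) : markK b rd1 rd1 (kStartW d 0 c₀) = kStartW d b c₀ := by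
  funext p q
  simp only [markK, kStartW, kRungR, rd1]
  rw [mul_right_comm, kProp_gE_zero_mul_wE_fst]

/-- The start propagator marked along `0 → u₀`. [cite: Hara2008, §3.4 (Step 1)] -/
theorem markK_rd2_rd2_kStartW (c b₀ : ℝ) : markK c rd2 rd2 (kStartW d b₀ 0) = kStartW d b₀ c := by
  funext p q
  simp only [markK, kStartW, kRungR, rd2]
  rw [mul_right_comm, kProp_gE_zero_mul_wE_snd]

/-- **The end propagator marked** along `z → x` / `t → x`. [cite: Hara2008, §3.4 (Step 1)] -/
theorem markK_rd1_rd1_kEndW (b c₀ : ℝ) : markK b rd1 rd1 (kEndW d 0 c₀) = kEndW d b c₀ := by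
  funext p q
  simp only [markK, kEndW, kRungL, rd1]
  rw [mul_assoc, kProp_gE_zero_mul_wE_fst]

/-- The end propagator marked along `t → x`. [cite: Hara2008, §3.4 (Step 1)] -/
theorem markK_rd2_rd2_kEndW (c b₀ : ℝ) : markK c rd2 rd2 (kEndW d b₀ 0) = kEndW d b₀ c := by
  funext p q
  simp only [markK, kEndW, kRungL, rd2]
  rw [mul_assoc, kProp_gE_zero_mul_wE_snd]

end Identify

/-! ### The master list with exponents, and marking as setting an exponent -/

section Surgery

variable {d : ℕ}

/-- No exponents. [folklore] -/
def eZero : ℕ → ℝ × ℝ := fun _ => (0, 0)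

/-- Path `P₁` uses the first exponent slot of the kernel at fine index `k` (the start; the kernels of odd
units; the end and the last `B₁` belong to unit `N`). [cite: HeydenreichVanDerHofstad2017, §7.5.2] -/
def pol (k : ℕ) : Prop := k = 0 ∨ ((k + 1) / 2) % 2 = 1

/-- `pol` is decidable. [folklore] -/
instance (k : ℕ) : Decidable (pol k) := by unfold pol; infer_instance

/-- Set the `P₁`-slot of the exponent at fine index `j` to `b`. [folklore] -/
def setB (ex : ℕ → ℝ × ℝ) (j : ℕ) (b : ℝ) : ℕ → ℝ × ℝ :=
  Function.update ex j (if pol j then (b, (ex j).2) else ((ex j).1, b))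

/-- Set the `P₂`-slot of the exponent at fine index `l` to `c`. [folklore] -/
def setC (ex : ℕ → ℝ × ℝ) (l : ℕ) (c : ℝ) : ℕ → ℝ × ℝ :=
  Function.update ex l (if pol l then ((ex l).1, c) else (c, (ex l).2))

/-- Unit `u` (`u ≥ 1`) with exponents: `[B̃₁^{ex(2u-1)}, B̃₂^{ex(2u)}]` and the readers of both paths.
[cite: HeydenreichVanDerHofstad2017, (7.4.10) and §7.5.2] -/
def unitTE (d : ℕ) (ex : ℕ → ℝ × ℝ) (u : ℕ) :
    List ((Site d × Site d → Site d × Site d → ℝ≥0∞) × (Site d × Site d → Site d) × (Site d × Site d → Site d)) :=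
  if u % 2 = 1 then
    [(kB1w d (ex (2 * u - 1)).1 (ex (2 * u - 1)).2, rd1, rd2), (kB2W d (ex (2 * u)).1 (ex (2 * u)).2, rd2, rd1)]
  else
    [(kB1w d (ex (2 * u - 1)).1 (ex (2 * u - 1)).2, rd2, rd1), (kB2W d (ex (2 * u)).1 (ex (2 * u)).2, rd1, rd2)]

/-- Units `i₀+1, …, i₀+k` with exponents. [cite: HeydenreichVanDerHofstad2017, (7.4.10)] -/
def blocksTE (d : ℕ) (ex : ℕ → ℝ × ℝ) (i₀ : ℕ) : ℕ →
    List ((Site d × Site d → Site d × Site d → ℝ≥0∞) × (Site d × Site d → Site d) × (Site d × Site d → Site d))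
  | 0 => []
  | k + 1 => unitTE d ex (i₀ + 1) ++ blocksTE d ex (i₀ + 1) k

/-- The last `B₁` with exponents. [cite: HeydenreichVanDerHofstad2017, (7.4.10)] -/
def finalTE (d : ℕ) (n : ℕ) (ex : ℕ → ℝ × ℝ) :
    (Site d × Site d → Site d × Site d → ℝ≥0∞) × (Site d × Site d → Site d) × (Site d × Site d → Site d) :=
  if (n + 1) % 2 = 1 then (kB1w d (ex (2 * n + 1)).1 (ex (2 * n + 1)).2, rd1, rd2)
  else (kB1w d (ex (2 * n + 1)).1 (ex (2 * n + 1)).2, rd2, rd1)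

/-- The end kernel with exponents. [cite: HeydenreichVanDerHofstad2017, (7.4.10)] -/
def endTE (d : ℕ) (n : ℕ) (ex : ℕ → ℝ × ℝ) :
    (Site d × Site d → Site d × Site d → ℝ≥0∞) × (Site d × Site d → Site d) × (Site d × Site d → Site d) :=
  if (n + 1) % 2 = 1 then (kEndW d (ex (2 * n + 2)).1 (ex (2 * n + 2)).2, rd1, rd2)
  else (kEndW d (ex (2 * n + 2)).1 (ex (2 * n + 2)).2, rd2, rd1)

/-- The start kernel with exponents. [cite: HeydenreichVanDerHofstad2017, (7.5.5)] -/
def startTE (d : ℕ) (ex : ℕ → ℝ × ℝ) :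
    (Site d × Site d → Site d × Site d → ℝ≥0∞) × (Site d × Site d → Site d) × (Site d × Site d → Site d) :=
  (kStartW d (ex 0).1 (ex 0).2, rd1, rd2)

/-- **The master list with exponents.** [cite: HeydenreichVanDerHofstad2017, (7.4.10)] -/
def masterTE (d : ℕ) (n : ℕ) (ex : ℕ → ℝ × ℝ) :
    List ((Site d × Site d → Site d × Site d → ℝ≥0∞) × (Site d × Site d → Site d) × (Site d × Site d → Site d)) :=
  startTE d ex :: (blocksTE d ex 0 n ++ [finalTE d n ex, endTE d n ex])

/-- The unmarked master list is the master list with zero exponents. [folklore] -/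
theorem masterT_eq_masterTE (n : ℕ) : masterT d n = masterTE d n eZero := by
  have hunit : ∀ u : ℕ, unitT d (decide (u % 2 = 1)) = unitTE d eZero u := by
    intro u
    unfold unitT unitTE eZero
    by_cases h : u % 2 = 1 <;> simp [h, kB1w_zero_zero, kB2W_zero_zero]
  have hblocks : ∀ k i₀, blocksFrom d i₀ k = blocksTE d eZero i₀ k := by
    intro k
    induction k with
    | zero => intro i₀; rfl
    | succ k ih => intro i₀; rw [blocksFrom, blocksTE, hunit, ih]
  rw [masterT, masterTE, hblocks]
  unfold startT startTE finalT finalTE endT endTE eZero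
  by_cases h : (n + 1) % 2 = 1 <;> simp [h, kB1w_zero_zero]

/-- The kernels of the units with exponents. [folklore] -/
def blocksKs (d : ℕ) (ex : ℕ → ℝ × ℝ) (i₀ : ℕ) : ℕ → List (Site d × Site d → Site d × Site d → ℝ≥0∞)
  | 0 => []
  | k + 1 => [kB1w d (ex (2 * (i₀ + 1) - 1)).1 (ex (2 * (i₀ + 1) - 1)).2,
      kB2W d (ex (2 * (i₀ + 1))).1 (ex (2 * (i₀ + 1))).2] ++ blocksKs d ex (i₀ + 1) k

/-- **The kernel list of the master list with exponents** (both views). [folklore] -/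
def mKsE (d : ℕ) (n : ℕ) (ex : ℕ → ℝ × ℝ) : List (Site d × Site d → Site d × Site d → ℝ≥0∞) :=
  kStartW d (ex 0).1 (ex 0).2 :: (blocksKs d ex 0 n ++
    [kB1w d (ex (2 * n + 1)).1 (ex (2 * n + 1)).2, kEndW d (ex (2 * n + 2)).1 (ex (2 * n + 2)).2])

/-- The kernels of a unit with exponents. [folklore] -/
theorem map_fst_unitTE (ex : ℕ → ℝ × ℝ) (u : ℕ) :
    (unitTE d ex u).map (·.1) = [kB1w d (ex (2 * u - 1)).1 (ex (2 * u - 1)).2, kB2W d (ex (2 * u)).1 (ex (2 * u)).2] := by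
  unfold unitTE; split <;> rfl

/-- The kernels of the units with exponents. [folklore] -/
theorem map_fst_blocksTE (ex : ℕ → ℝ × ℝ) (i₀ k : ℕ) : (blocksTE d ex i₀ k).map (·.1) = blocksKs d ex i₀ k := by
  induction k generalizing i₀ with
  | zero => rfl
  | succ k ih => rw [blocksTE, blocksKs, List.map_append, map_fst_unitTE, ih]

/-- The `Φ`-view kernels of the master list with exponents. [folklore] -/
theorem kernelsOf_masterTE_toΦ (n : ℕ) (ex : ℕ → ℝ × ℝ) : kernelsOf ((masterTE d n ex).map toΦ) = mKsE d n ex := by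
  rw [kernelsOf, List.map_map, show (Prod.fst ∘ toΦ) = fun x :
      (Site d × Site d → Site d × Site d → ℝ≥0∞) × (Site d × Site d → Site d) × (Site d × Site d → Site d) => x.1
      from rfl, masterTE, List.map_cons, List.map_append, map_fst_blocksTE, mKsE]
  unfold startTE finalTE endTE
  by_cases h : (n + 1) % 2 = 1 <;> simp [h]

/-- The `Ψ`-view kernels of the master list with exponents. [folklore] -/
theorem kernelsOf_masterTE_toΨ (n : ℕ) (ex : ℕ → ℝ × ℝ) : kernelsOf ((masterTE d n ex).map toΨ) = mKsE d n ex := by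
  rw [← kernelsOf_map_toΦ_eq]; exact kernelsOf_masterTE_toΦ n ex

/-- The exponent slots of path `P₁` all vanish. [folklore] -/
def P1zero (ex : ℕ → ℝ × ℝ) : Prop := ∀ k, (if pol k then (ex k).1 else (ex k).2) = 0

/-- The exponent slots of path `P₂` all vanish. [folklore] -/
def P2zero (ex : ℕ → ℝ × ℝ) : Prop := ∀ k, (if pol k then (ex k).2 else (ex k).1) = 0

/-- Zero exponents have vanishing `P₁`-slots. [folklore] -/
theorem p1zero_eZero : P1zero eZero := fun k => by unfold eZero; split <;> rfl

/-- Setting a `P₁`-slot keeps the `P₂`-slots. [folklore] -/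
theorem p2zero_setB {ex : ℕ → ℝ × ℝ} (h : P2zero ex) (j : ℕ) (b : ℝ) : P2zero (setB ex j b) := by
  intro k
  unfold setB
  by_cases hk : k = j
  · subst hk
    rw [Function.update_self]
    have := h k
    by_cases hp : pol k <;> simp [hp] at this ⊢ <;> exact this
  · rw [Function.update_of_ne hk]; exact h k

/-- The reader of `P₁` after unit `u` (`u = 0`: after the start). [cite: HeydenreichVanDerHofstad2017, §7.5.2] -/
def φAfter (u : ℕ) : Site d × Site d → Site d := if u % 2 = 1 then rd2 else rd1

/-- The reader of `P₂` after unit `u`. [cite: HeydenreichVanDerHofstad2017, §7.5.2] -/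
def ψAfter (u : ℕ) : Site d × Site d → Site d := if u % 2 = 1 then rd1 else rd2

/-- In an odd unit path `P₁` uses the first slots. [folklore] -/
theorem pol_of_odd {u : ℕ} (hu : u % 2 = 1) (_hu0 : 0 < u) : pol (2 * u - 1) ∧ pol (2 * u) := by
  refine ⟨Or.inr ?_, Or.inr ?_⟩ <;> omega

/-- In an even unit path `P₁` uses the second slots. [folklore] -/
theorem not_pol_of_even {u : ℕ} (hu : ¬ u % 2 = 1) (hu0 : 0 < u) : ¬ pol (2 * u - 1) ∧ ¬ pol (2 * u) := by
  refine ⟨?_, ?_⟩ <;> rintro (h | h) <;> omega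

/-- Units read exponents only at their own fine indices. [folklore] -/
theorem unitTE_congr {ex ex' : ℕ → ℝ × ℝ} (u : ℕ) (h1 : ex (2 * u - 1) = ex' (2 * u - 1)) (h2 : ex (2 * u) = ex' (2 * u)) :
    unitTE d ex u = unitTE d ex' u := by
  unfold unitTE; rw [h1, h2]

/-- The units read exponents only in their own range. [folklore] -/
theorem blocksTE_congr {ex ex' : ℕ → ℝ × ℝ} (i₀ k : ℕ) (h : ∀ idx, 2 * i₀ < idx → idx ≤ 2 * (i₀ + k) → ex idx = ex' idx) :
    blocksTE d ex i₀ k = blocksTE d ex' i₀ k := by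
  induction k generalizing i₀ with
  | zero => rfl
  | succ k ih =>
    rw [blocksTE, blocksTE, unitTE_congr (i₀ + 1) (h _ (by omega) (by omega)) (h _ (by omega) (by omega)),
      ih (i₀ + 1) fun idx h1 h2 => h idx (by omega) (by omega)]

/-- **Marking along `P₁` inside the units** (Lemma A): with previous reader `φAfter i₀`, marking local index
`m < 2k` sets the `P₁`-slot of fine index `2i₀ + 1 + m`; larger `m` passes to the tail.
[cite: Hara2008, §3.4 (Step 1)] -/
theorem markAt₁_blocksTE {ex : ℕ → ℝ × ℝ} (hex : P1zero ex) (b : ℝ) (k : ℕ) : ∀ (i₀ m : ℕ)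
    (tail : List ((Site d × Site d → Site d × Site d → ℝ≥0∞) × (Site d × Site d → Site d) × (Site d × Site d → Site d))),
    markAt₁ b (φAfter i₀) m (blocksTE d ex i₀ k ++ tail) =
      if m < 2 * k then blocksTE d (setB ex (2 * i₀ + 1 + m) b) i₀ k ++ tail
      else blocksTE d ex i₀ k ++ markAt₁ b (φAfter (i₀ + k)) (m - 2 * k) tail := by
  induction k with
  | zero => intro i₀ m tail; simp [blocksTE]
  | succ k ih =>
    intro i₀ m tail
    have hu0 : 0 < i₀ + 1 := Nat.succ_pos _
    -- the two kernels of unit `i₀ + 1`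
    rcases m with _ | _ | m
    · -- mark the `B₁` of unit `i₀+1` (fine index `2i₀+1`)
      rw [if_pos (by omega), blocksTE, blocksTE, List.append_assoc, List.append_assoc]
      have hidx : 2 * i₀ + 1 + 0 = 2 * (i₀ + 1) - 1 := by omega
      rw [hidx, blocksTE_congr (ex := setB ex (2 * (i₀ + 1) - 1) b) (ex' := ex) (i₀ + 1) k
        fun idx h1 _ => by rw [setB, Function.update_of_ne (by omega)]]
      unfold unitTE φAfter
      by_cases hu : (i₀ + 1) % 2 = 1
      · have hi₀ : ¬ i₀ % 2 = 1 := by omega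
        have hp := (pol_of_odd hu hu0).1
        have h0 : (ex (2 * (i₀ + 1) - 1)).1 = 0 := by have := hex (2 * (i₀ + 1) - 1); rwa [if_pos hp] at this
        simp only [hu, hi₀, if_true, if_false, List.cons_append, List.nil_append, markAt₁]
        rw [show kB1w d (ex (2 * (i₀ + 1) - 1)).1 (ex (2 * (i₀ + 1) - 1)).2 = kB1w d 0 (ex (2 * (i₀ + 1) - 1)).2 by rw [h0],
          markK_rd1_rd1_kB1w]
        simp [setB, hp, Function.update_of_ne (show 2 * (i₀ + 1) ≠ 2 * (i₀ + 1) - 1 by omega)]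
      · have hi₀ : i₀ % 2 = 1 := by omega
        have hp := (not_pol_of_even hu hu0).1
        have h0 : (ex (2 * (i₀ + 1) - 1)).2 = 0 := by have := hex (2 * (i₀ + 1) - 1); rwa [if_neg hp] at this
        simp only [hu, hi₀, if_true, if_false, List.cons_append, List.nil_append, markAt₁]
        rw [show kB1w d (ex (2 * (i₀ + 1) - 1)).1 (ex (2 * (i₀ + 1) - 1)).2 = kB1w d (ex (2 * (i₀ + 1) - 1)).1 0 by rw [h0],
          markK_rd2_rd2_kB1w]
        simp [setB, hp, Function.update_of_ne (show 2 * (i₀ + 1) ≠ 2 * (i₀ + 1) - 1 by omega)]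
    · -- mark the `B₂` of unit `i₀+1` (fine index `2i₀+2`)
      rw [if_pos (by omega), blocksTE, blocksTE, List.append_assoc, List.append_assoc]
      have hidx : 2 * i₀ + 1 + (0 + 1) = 2 * (i₀ + 1) := by omega
      rw [hidx, blocksTE_congr (ex := setB ex (2 * (i₀ + 1)) b) (ex' := ex) (i₀ + 1) k
        fun idx h1 _ => by rw [setB, Function.update_of_ne (by omega)]]
      unfold unitTE φAfter
      by_cases hu : (i₀ + 1) % 2 = 1
      · have hi₀ : ¬ i₀ % 2 = 1 := by omega
        have hp := (pol_of_odd hu hu0).2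
        have h0 : (ex (2 * (i₀ + 1))).1 = 0 := by have := hex (2 * (i₀ + 1)); rwa [if_pos hp] at this
        simp only [hu, hi₀, if_true, if_false, List.cons_append, List.nil_append, markAt₁]
        rw [show kB2W d (ex (2 * (i₀ + 1))).1 (ex (2 * (i₀ + 1))).2 = kB2W d 0 (ex (2 * (i₀ + 1))).2 by rw [h0],
          markK_rd1_rd2_kB2W]
        simp [setB, hp, Function.update_of_ne (show 2 * (i₀ + 1) - 1 ≠ 2 * (i₀ + 1) by omega)]
      · have hi₀ : i₀ % 2 = 1 := by omega
        have hp := (not_pol_of_even hu hu0).2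
        have h0 : (ex (2 * (i₀ + 1))).2 = 0 := by have := hex (2 * (i₀ + 1)); rwa [if_neg hp] at this
        simp only [hu, hi₀, if_true, if_false, List.cons_append, List.nil_append, markAt₁]
        rw [show kB2W d (ex (2 * (i₀ + 1))).1 (ex (2 * (i₀ + 1))).2 = kB2W d (ex (2 * (i₀ + 1))).1 0 by rw [h0],
          markK_rd2_rd1_kB2W]
        simp [setB, hp, Function.update_of_ne (show 2 * (i₀ + 1) - 1 ≠ 2 * (i₀ + 1) by omega)]
    · -- pass through unit `i₀+1`
      rw [blocksTE, List.append_assoc]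
      have hφ : φAfter (d := d) (i₀ + 1) = (if (i₀ + 1) % 2 = 1 then rd2 else rd1) := rfl
      have step : markAt₁ b (φAfter i₀) (m + 1 + 1) (unitTE d ex (i₀ + 1) ++ (blocksTE d ex (i₀ + 1) k ++ tail)) =
          unitTE d ex (i₀ + 1) ++ markAt₁ b (φAfter (i₀ + 1)) m (blocksTE d ex (i₀ + 1) k ++ tail) := by
        unfold unitTE φAfter
        by_cases hu : (i₀ + 1) % 2 = 1
        · have hi₀ : ¬ i₀ % 2 = 1 := by omega
          simp only [hu, hi₀, if_true, if_false, List.cons_append, List.nil_append, markAt₁]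
        · have hi₀ : i₀ % 2 = 1 := by omega
          simp only [hu, hi₀, if_true, if_false, List.cons_append, List.nil_append, markAt₁]
      rw [step, ih (i₀ + 1) m tail]
      by_cases hm : m < 2 * k
      · rw [if_pos hm, if_pos (by omega), show 2 * i₀ + 1 + (m + 1 + 1) = 2 * (i₀ + 1) + 1 + m by ring]
        simp only [blocksTE, List.append_assoc]
        congr 1
        exact unitTE_congr (i₀ + 1) (by rw [setB, Function.update_of_ne (by omega)])
          (by rw [setB, Function.update_of_ne (by omega)])
      · rw [if_neg hm, if_neg (by omega), show m + 1 + 1 - 2 * (k + 1) = m - 2 * k by omega,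
          show i₀ + (k + 1) = i₀ + 1 + k by ring]
        simp only [List.append_assoc]

end Surgery

/-! ### Marking the master list: along `P₁` (triples) and along `P₂` (the `Ψ`-view) -/

section SurgeryMaster

variable {d : ℕ}

/-- At the start path `P₁` uses the first slot. [folklore] -/
theorem pol_zero : pol 0 := Or.inl rfl

/-- The last `B₁` belongs to unit `N = n+1`. [folklore] -/
theorem pol_final_iff (n : ℕ) : pol (2 * n + 1) ↔ (n + 1) % 2 = 1 := by
  unfold pol; constructor
  · rintro (h | h) <;> omega
  · intro h; right; omega

/-- The end kernel belongs to unit `N = n+1`. [folklore] -/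
theorem pol_end_iff (n : ℕ) : pol (2 * n + 2) ↔ (n + 1) % 2 = 1 := by
  unfold pol; constructor
  · rintro (h | h) <;> omega
  · intro h; right; omega

/-- The `P₁`-reader after the start. [folklore] -/
theorem φAfter_zero : φAfter (d := d) 0 = rd1 := by simp [φAfter]

/-- The `P₂`-reader after the start. [folklore] -/
theorem ψAfter_zero : ψAfter (d := d) 0 = rd2 := by simp [ψAfter]


/-- The last `B₁` of an odd unit `N`. [folklore] -/
theorem finalTE_odd {n : ℕ} (h : (n + 1) % 2 = 1) (ex : ℕ → ℝ × ℝ) :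
    finalTE d n ex = (kB1w d (ex (2 * n + 1)).1 (ex (2 * n + 1)).2, rd1, rd2) := if_pos h

/-- The last `B₁` of an even unit `N`. [folklore] -/
theorem finalTE_even {n : ℕ} (h : ¬ (n + 1) % 2 = 1) (ex : ℕ → ℝ × ℝ) :
    finalTE d n ex = (kB1w d (ex (2 * n + 1)).1 (ex (2 * n + 1)).2, rd2, rd1) := if_neg h

/-- The end kernel of an odd unit `N`. [folklore] -/
theorem endTE_odd {n : ℕ} (h : (n + 1) % 2 = 1) (ex : ℕ → ℝ × ℝ) :
    endTE d n ex = (kEndW d (ex (2 * n + 2)).1 (ex (2 * n + 2)).2, rd1, rd2) := if_pos h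

/-- The end kernel of an even unit `N`. [folklore] -/
theorem endTE_even {n : ℕ} (h : ¬ (n + 1) % 2 = 1) (ex : ℕ → ℝ × ℝ) :
    endTE d n ex = (kEndW d (ex (2 * n + 2)).1 (ex (2 * n + 2)).2, rd2, rd1) := if_neg h

/-- The `P₁`-reader before an odd unit. [folklore] -/
theorem φAfter_of_succ_odd {n : ℕ} (h : (n + 1) % 2 = 1) : φAfter (d := d) n = rd1 := if_neg (by omega)

/-- The `P₁`-reader before an even unit. [folklore] -/
theorem φAfter_of_succ_even {n : ℕ} (h : ¬ (n + 1) % 2 = 1) : φAfter (d := d) n = rd2 := if_pos (by omega)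

/-- The `P₂`-reader before an odd unit. [folklore] -/
theorem ψAfter_of_succ_odd {n : ℕ} (h : (n + 1) % 2 = 1) : ψAfter (d := d) n = rd2 := if_neg (by omega)

/-- The `P₂`-reader before an even unit. [folklore] -/
theorem ψAfter_of_succ_even {n : ℕ} (h : ¬ (n + 1) % 2 = 1) : ψAfter (d := d) n = rd1 := if_pos (by omega)

/-- **Marking the master list along `P₁` sets one exponent**: for `j < 2n+3` and exponents with vanishing
`P₁`-slots, `markAt₁ b rd1 j (masterTE n ex) = masterTE n (setB ex j b)`. [cite: Hara2008, §3.4 (Step 1)] -/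
theorem markAt₁_masterTE {ex : ℕ → ℝ × ℝ} (hex : P1zero ex) (b : ℝ) (n : ℕ) {j : ℕ} (hj : j < 2 * n + 3) :
    markAt₁ b rd1 j (masterTE d n ex) = masterTE d n (setB ex j b) := by
  rcases j with _ | j
  · -- the start kernel
    have h0 : (ex 0).1 = 0 := by have := hex 0; rwa [if_pos pol_zero] at this
    rw [masterTE, masterTE, markAt₁]
    congr 1
    · unfold startTE
      rw [show kStartW d (ex 0).1 (ex 0).2 = kStartW d 0 (ex 0).2 by rw [h0], markK_rd1_rd1_kStartW]
      simp [setB, pol_zero]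
    · rw [blocksTE_congr (ex := ex) (ex' := setB ex 0 b) 0 n fun idx h1 _ => by
        rw [setB, Function.update_of_ne (by omega)]]
      unfold finalTE endTE
      rw [show setB ex 0 b (2 * n + 1) = ex (2 * n + 1) by rw [setB, Function.update_of_ne (by omega)],
        show setB ex 0 b (2 * n + 2) = ex (2 * n + 2) by rw [setB, Function.update_of_ne (by omega)]]
  · -- inside the units or at the last two kernels
    rw [masterTE, masterTE, markAt₁]
    have hφ : (startTE d ex).2.1 = φAfter (d := d) 0 := by rw [φAfter_zero]; rfl
    rw [hφ, markAt₁_blocksTE hex b n 0 j [finalTE d n ex, endTE d n ex]]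
    have hstart : startTE d ex = startTE d (setB ex (j + 1) b) := by
      unfold startTE; rw [show setB ex (j + 1) b 0 = ex 0 by rw [setB, Function.update_of_ne (by omega)]]
    by_cases hjn : j < 2 * n
    · rw [if_pos hjn, show 2 * 0 + 1 + j = j + 1 by ring, hstart]
      congr 2
      unfold finalTE endTE
      rw [show setB ex (j + 1) b (2 * n + 1) = ex (2 * n + 1) by rw [setB, Function.update_of_ne (by omega)],
        show setB ex (j + 1) b (2 * n + 2) = ex (2 * n + 2) by rw [setB, Function.update_of_ne (by omega)]]
    · rw [if_neg hjn, zero_add, hstart]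
      have hblocks : ∀ idx', 2 * n < idx' → blocksTE d ex 0 n = blocksTE d (setB ex idx' b) 0 n := fun idx' hidx' =>
        blocksTE_congr 0 n fun idx _ h2 => by rw [setB, Function.update_of_ne (by omega)]
      rcases Nat.lt_or_ge (j - 2 * n) 1 with hj0 | hj1
      · -- the last `B₁` (fine index `2n+1`)
        have hjeq : j + 1 = 2 * n + 1 := by omega
        rw [show j - 2 * n = 0 by omega, hjeq, hblocks (2 * n + 1) (by omega)]
        congr 2
        have h22 : setB ex (2 * n + 1) b (2 * n + 2) = ex (2 * n + 2) := by rw [setB, Function.update_of_ne (by omega)]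
        by_cases hn : (n + 1) % 2 = 1
        · have hp : pol (2 * n + 1) := (pol_final_iff n).2 hn
          have h0 : (ex (2 * n + 1)).1 = 0 := by have := hex (2 * n + 1); rwa [if_pos hp] at this
          simp only [finalTE_odd hn, endTE_odd hn, φAfter_of_succ_odd hn, markAt₁, h22]
          rw [show kB1w d (ex (2 * n + 1)).1 (ex (2 * n + 1)).2 = kB1w d 0 (ex (2 * n + 1)).2 by rw [h0],
            markK_rd1_rd1_kB1w]
          simp [setB, hp]
        · have hp : ¬ pol (2 * n + 1) := fun h => hn ((pol_final_iff n).1 h)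
          have h0 : (ex (2 * n + 1)).2 = 0 := by have := hex (2 * n + 1); rwa [if_neg hp] at this
          simp only [finalTE_even hn, endTE_even hn, φAfter_of_succ_even hn, markAt₁, h22]
          rw [show kB1w d (ex (2 * n + 1)).1 (ex (2 * n + 1)).2 = kB1w d (ex (2 * n + 1)).1 0 by rw [h0],
            markK_rd2_rd2_kB1w]
          simp [setB, hp]
      · -- the end kernel (fine index `2n+2`)
        have hjeq : j + 1 = 2 * n + 2 := by omega
        rw [show j - 2 * n = 1 by omega, hjeq, hblocks (2 * n + 2) (by omega)]
        congr 2
        have h21 : setB ex (2 * n + 2) b (2 * n + 1) = ex (2 * n + 1) := by rw [setB, Function.update_of_ne (by omega)]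
        by_cases hn : (n + 1) % 2 = 1
        · have hp : pol (2 * n + 2) := (pol_end_iff n).2 hn
          have h0 : (ex (2 * n + 2)).1 = 0 := by have := hex (2 * n + 2); rwa [if_pos hp] at this
          simp only [finalTE_odd hn, endTE_odd hn, markAt₁, h21]
          rw [show kEndW d (ex (2 * n + 2)).1 (ex (2 * n + 2)).2 = kEndW d 0 (ex (2 * n + 2)).2 by rw [h0],
            markK_rd1_rd1_kEndW]
          simp [setB, hp]
        · have hp : ¬ pol (2 * n + 2) := fun h => hn ((pol_end_iff n).1 h)
          have h0 : (ex (2 * n + 2)).2 = 0 := by have := hex (2 * n + 2); rwa [if_neg hp] at this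
          simp only [finalTE_even hn, endTE_even hn, markAt₁, h21]
          rw [show kEndW d (ex (2 * n + 2)).1 (ex (2 * n + 2)).2 = kEndW d (ex (2 * n + 2)).1 0 by rw [h0],
            markK_rd2_rd2_kEndW]
          simp [setB, hp]

/-- **Marking along `P₂` inside the units** (Lemma A for the `Ψ`-view): with previous reader `ψAfter i₀`.
[cite: Hara2008, §3.4 (Step 1)] -/
theorem markAt_blocksTE_toΨ {ex : ℕ → ℝ × ℝ} (hex : P2zero ex) (c : ℝ) (k : ℕ) : ∀ (i₀ m : ℕ)
    (tail : List ((Site d × Site d → Site d × Site d → ℝ≥0∞) × (Site d × Site d → Site d) × (Site d × Site d → Site d))),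
    markAt c (ψAfter i₀) m ((blocksTE d ex i₀ k ++ tail).map toΨ) =
      if m < 2 * k then (blocksTE d (setC ex (2 * i₀ + 1 + m) c) i₀ k ++ tail).map toΨ
      else (blocksTE d ex i₀ k).map toΨ ++ markAt c (ψAfter (i₀ + k)) (m - 2 * k) (tail.map toΨ) := by
  induction k with
  | zero => intro i₀ m tail; simp [blocksTE]
  | succ k ih =>
    intro i₀ m tail
    have hu0 : 0 < i₀ + 1 := Nat.succ_pos _
    rcases m with _ | _ | m
    · -- mark the `B₁` of unit `i₀+1` along `P₂`
      rw [if_pos (by omega), blocksTE, blocksTE, List.append_assoc, List.append_assoc]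
      have hidx : 2 * i₀ + 1 + 0 = 2 * (i₀ + 1) - 1 := by omega
      rw [hidx, blocksTE_congr (ex := setC ex (2 * (i₀ + 1) - 1) c) (ex' := ex) (i₀ + 1) k
        fun idx h1 _ => by rw [setC, Function.update_of_ne (by omega)]]
      unfold unitTE ψAfter
      by_cases hu : (i₀ + 1) % 2 = 1
      · have hi₀ : ¬ i₀ % 2 = 1 := by omega
        have hp := (pol_of_odd hu hu0).1
        have h0 : (ex (2 * (i₀ + 1) - 1)).2 = 0 := by have := hex (2 * (i₀ + 1) - 1); rwa [if_pos hp] at this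
        simp only [hu, hi₀, if_true, if_false, List.cons_append, List.nil_append, List.map_cons, List.map_append,
          markAt, toΨ]
        rw [show kB1w d (ex (2 * (i₀ + 1) - 1)).1 (ex (2 * (i₀ + 1) - 1)).2 = kB1w d (ex (2 * (i₀ + 1) - 1)).1 0 by rw [h0],
          markK_rd2_rd2_kB1w]
        simp [setC, hp, Function.update_of_ne (show 2 * (i₀ + 1) ≠ 2 * (i₀ + 1) - 1 by omega)]
      · have hi₀ : i₀ % 2 = 1 := by omega
        have hp := (not_pol_of_even hu hu0).1
        have h0 : (ex (2 * (i₀ + 1) - 1)).1 = 0 := by have := hex (2 * (i₀ + 1) - 1); rwa [if_neg hp] at this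
        simp only [hu, hi₀, if_true, if_false, List.cons_append, List.nil_append, List.map_cons, List.map_append,
          markAt, toΨ]
        rw [show kB1w d (ex (2 * (i₀ + 1) - 1)).1 (ex (2 * (i₀ + 1) - 1)).2 = kB1w d 0 (ex (2 * (i₀ + 1) - 1)).2 by rw [h0],
          markK_rd1_rd1_kB1w]
        simp [setC, hp, Function.update_of_ne (show 2 * (i₀ + 1) ≠ 2 * (i₀ + 1) - 1 by omega)]
    · -- mark the `B₂` of unit `i₀+1` along `P₂`
      rw [if_pos (by omega), blocksTE, blocksTE, List.append_assoc, List.append_assoc]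
      have hidx : 2 * i₀ + 1 + (0 + 1) = 2 * (i₀ + 1) := by omega
      rw [hidx, blocksTE_congr (ex := setC ex (2 * (i₀ + 1)) c) (ex' := ex) (i₀ + 1) k
        fun idx h1 _ => by rw [setC, Function.update_of_ne (by omega)]]
      unfold unitTE ψAfter
      by_cases hu : (i₀ + 1) % 2 = 1
      · have hi₀ : ¬ i₀ % 2 = 1 := by omega
        have hp := (pol_of_odd hu hu0).2
        have h0 : (ex (2 * (i₀ + 1))).2 = 0 := by have := hex (2 * (i₀ + 1)); rwa [if_pos hp] at this
        simp only [hu, hi₀, if_true, if_false, List.cons_append, List.nil_append, List.map_cons, List.map_append,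
          markAt, toΨ]
        rw [show kB2W d (ex (2 * (i₀ + 1))).1 (ex (2 * (i₀ + 1))).2 = kB2W d (ex (2 * (i₀ + 1))).1 0 by rw [h0],
          markK_rd2_rd1_kB2W]
        simp [setC, hp, Function.update_of_ne (show 2 * (i₀ + 1) - 1 ≠ 2 * (i₀ + 1) by omega)]
      · have hi₀ : i₀ % 2 = 1 := by omega
        have hp := (not_pol_of_even hu hu0).2
        have h0 : (ex (2 * (i₀ + 1))).1 = 0 := by have := hex (2 * (i₀ + 1)); rwa [if_neg hp] at this
        simp only [hu, hi₀, if_true, if_false, List.cons_append, List.nil_append, List.map_cons, List.map_append,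
          markAt, toΨ]
        rw [show kB2W d (ex (2 * (i₀ + 1))).1 (ex (2 * (i₀ + 1))).2 = kB2W d 0 (ex (2 * (i₀ + 1))).2 by rw [h0],
          markK_rd1_rd2_kB2W]
        simp [setC, hp, Function.update_of_ne (show 2 * (i₀ + 1) - 1 ≠ 2 * (i₀ + 1) by omega)]
    · -- pass through unit `i₀+1`
      rw [blocksTE, List.append_assoc]
      have step : markAt c (ψAfter i₀) (m + 1 + 1) ((unitTE d ex (i₀ + 1) ++ (blocksTE d ex (i₀ + 1) k ++ tail)).map toΨ) =
          (unitTE d ex (i₀ + 1)).map toΨ ++ markAt c (ψAfter (i₀ + 1)) m ((blocksTE d ex (i₀ + 1) k ++ tail).map toΨ) := by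
        unfold unitTE ψAfter
        by_cases hu : (i₀ + 1) % 2 = 1
        · have hi₀ : ¬ i₀ % 2 = 1 := by omega
          simp only [hu, hi₀, if_true, if_false, List.cons_append, List.nil_append, List.map_cons, List.map_nil,
            markAt, toΨ]
        · have hi₀ : i₀ % 2 = 1 := by omega
          simp only [hu, hi₀, if_true, if_false, List.cons_append, List.nil_append, List.map_cons, List.map_nil,
            markAt, toΨ]
      rw [step, ih (i₀ + 1) m tail]
      by_cases hm : m < 2 * k
      · rw [if_pos hm, if_pos (by omega), show 2 * i₀ + 1 + (m + 1 + 1) = 2 * (i₀ + 1) + 1 + m by ring]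
        simp only [blocksTE, List.append_assoc, List.map_append]
        congr 2
        exact unitTE_congr (i₀ + 1) (by rw [setC, Function.update_of_ne (by omega)])
          (by rw [setC, Function.update_of_ne (by omega)])
      · rw [if_neg hm, if_neg (by omega), show m + 1 + 1 - 2 * (k + 1) = m - 2 * k by omega,
          show i₀ + (k + 1) = i₀ + 1 + k by ring]
        simp only [List.append_assoc, List.map_append]

/-- Zero exponents have vanishing `P₂`-slots. [folklore] -/
theorem p2zero_eZero : P2zero eZero := fun k => by unfold eZero; split <;> rfl

/-- **Marking the master list along `P₂` sets one exponent**: for `l < 2n+3` and exponents with vanishing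
`P₂`-slots, `markAt c rd2 l ((masterTE n ex).map toΨ) = (masterTE n (setC ex l c)).map toΨ`.
[cite: Hara2008, §3.4 (Step 1)] -/
theorem markAt_masterTE_toΨ {ex : ℕ → ℝ × ℝ} (hex : P2zero ex) (c : ℝ) (n : ℕ) {l : ℕ} (hl : l < 2 * n + 3) :
    markAt c rd2 l ((masterTE d n ex).map toΨ) = (masterTE d n (setC ex l c)).map toΨ := by
  rcases l with _ | l
  · -- the start kernel
    have h0 : (ex 0).2 = 0 := by have := hex 0; rwa [if_pos pol_zero] at this
    rw [masterTE, masterTE, List.map_cons, List.map_cons, markAt]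
    congr 1
    · unfold startTE toΨ
      dsimp only
      rw [show kStartW d (ex 0).1 (ex 0).2 = kStartW d (ex 0).1 0 by rw [h0], markK_rd2_rd2_kStartW]
      simp [setC, pol_zero]
    · rw [blocksTE_congr (ex := ex) (ex' := setC ex 0 c) 0 n fun idx h1 _ => by
        rw [setC, Function.update_of_ne (by omega)]]
      unfold finalTE endTE
      rw [show setC ex 0 c (2 * n + 1) = ex (2 * n + 1) by rw [setC, Function.update_of_ne (by omega)],
        show setC ex 0 c (2 * n + 2) = ex (2 * n + 2) by rw [setC, Function.update_of_ne (by omega)]]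
  · rw [masterTE, masterTE, List.map_cons, List.map_cons, markAt]
    have hψ : (toΨ (startTE d ex)).2 = ψAfter (d := d) 0 := by rw [ψAfter_zero]; rfl
    rw [hψ, markAt_blocksTE_toΨ hex c n 0 l [finalTE d n ex, endTE d n ex]]
    have hstart : startTE d ex = startTE d (setC ex (l + 1) c) := by
      unfold startTE; rw [show setC ex (l + 1) c 0 = ex 0 by rw [setC, Function.update_of_ne (by omega)]]
    by_cases hln : l < 2 * n
    · rw [if_pos hln, show 2 * 0 + 1 + l = l + 1 by ring, hstart, List.map_append, List.map_append]
      congr 3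
      unfold finalTE endTE
      rw [show setC ex (l + 1) c (2 * n + 1) = ex (2 * n + 1) by rw [setC, Function.update_of_ne (by omega)],
        show setC ex (l + 1) c (2 * n + 2) = ex (2 * n + 2) by rw [setC, Function.update_of_ne (by omega)]]
    · rw [if_neg hln, zero_add, hstart, List.map_append]
      have hblocks : ∀ idx', 2 * n < idx' → blocksTE d ex 0 n = blocksTE d (setC ex idx' c) 0 n := fun idx' hidx' =>
        blocksTE_congr 0 n fun idx _ h2 => by rw [setC, Function.update_of_ne (by omega)]
      rcases Nat.lt_or_ge (l - 2 * n) 1 with hl0 | hl1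
      · have hleq : l + 1 = 2 * n + 1 := by omega
        rw [show l - 2 * n = 0 by omega, hleq, hblocks (2 * n + 1) (by omega)]
        congr 2
        have h22 : setC ex (2 * n + 1) c (2 * n + 2) = ex (2 * n + 2) := by rw [setC, Function.update_of_ne (by omega)]
        by_cases hn : (n + 1) % 2 = 1
        · have hp : pol (2 * n + 1) := (pol_final_iff n).2 hn
          have h0 : (ex (2 * n + 1)).2 = 0 := by have := hex (2 * n + 1); rwa [if_pos hp] at this
          simp only [finalTE_odd hn, endTE_odd hn, ψAfter_of_succ_odd hn, List.map_cons, List.map_nil, markAt, toΨ, h22]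
          rw [show kB1w d (ex (2 * n + 1)).1 (ex (2 * n + 1)).2 = kB1w d (ex (2 * n + 1)).1 0 by rw [h0],
            markK_rd2_rd2_kB1w]
          simp [setC, hp]
        · have hp : ¬ pol (2 * n + 1) := fun h => hn ((pol_final_iff n).1 h)
          have h0 : (ex (2 * n + 1)).1 = 0 := by have := hex (2 * n + 1); rwa [if_neg hp] at this
          simp only [finalTE_even hn, endTE_even hn, ψAfter_of_succ_even hn, List.map_cons, List.map_nil, markAt, toΨ, h22]
          rw [show kB1w d (ex (2 * n + 1)).1 (ex (2 * n + 1)).2 = kB1w d 0 (ex (2 * n + 1)).2 by rw [h0],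
            markK_rd1_rd1_kB1w]
          simp [setC, hp]
      · have hleq : l + 1 = 2 * n + 2 := by omega
        rw [show l - 2 * n = 1 by omega, hleq, hblocks (2 * n + 2) (by omega)]
        congr 2
        have h21 : setC ex (2 * n + 2) c (2 * n + 1) = ex (2 * n + 1) := by rw [setC, Function.update_of_ne (by omega)]
        by_cases hn : (n + 1) % 2 = 1
        · have hp : pol (2 * n + 2) := (pol_end_iff n).2 hn
          have h0 : (ex (2 * n + 2)).2 = 0 := by have := hex (2 * n + 2); rwa [if_pos hp] at this
          simp only [finalTE_odd hn, endTE_odd hn, ψAfter_of_succ_odd hn, List.map_cons, List.map_nil, markAt, toΨ, h21]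
          rw [show kEndW d (ex (2 * n + 2)).1 (ex (2 * n + 2)).2 = kEndW d (ex (2 * n + 2)).1 0 by rw [h0],
            markK_rd2_rd2_kEndW]
          simp [setC, hp]
        · have hp : ¬ pol (2 * n + 2) := fun h => hn ((pol_end_iff n).1 h)
          have h0 : (ex (2 * n + 2)).1 = 0 := by have := hex (2 * n + 2); rwa [if_neg hp] at this
          simp only [finalTE_even hn, endTE_even hn, ψAfter_of_succ_even hn, List.map_cons, List.map_nil, markAt, toΨ, h21]
          rw [show kEndW d (ex (2 * n + 2)).1 (ex (2 * n + 2)).2 = kEndW d 0 (ex (2 * n + 2)).2 by rw [h0],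
            markK_rd1_rd1_kEndW]
          simp [setC, hp]

/-- **The doubly marked chain of the diagram is the chain over the master kernels with two exponents set.**
[cite: Hara2008, §3.4 (Step 1)] -/
theorem dmChain_masterT_eq (b c : ℝ) (n : ℕ) {j l : ℕ} (hj : j < 2 * n + 3) (hl : l < 2 * n + 3)
    (e : Site d × Site d → ℝ≥0∞) :
    dmChain d b c rd1 rd2 (masterT d n) j l e =
      ∑' p, pkChainL (vDelta d) (mKsE d n (setC (setB eZero j b) l c)) p * e p := by
  rw [dmChain, masterT_eq_masterTE, markAt₁_masterTE p1zero_eZero b n hj,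
    markAt_masterTE_toΨ (p2zero_setB p2zero_eZero j b) c n hl, kernelsOf_masterTE_toΨ]

end SurgeryMaster

end Literature.Barriers.CriticalPhenomena
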